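import Literature.Topology.FourManifolds.ArnoldRokhlinQuotientProofs
import Literature.Topology.FourManifolds.ConjQuotientAtlas
import Literature.Geometry.Kaehler.Kaehler
import HarnessLib

/-!
# The Arnold–Rokhlin quotient `X/conj` (`Finashin1996_conjQuotient_exists`): fact decomposition —
# existence of a `σ`-adapted atlas as the one named input

Topic `Literature/Topology/FourManifolds`; namespace `Literature.Topology.FourManifolds`. FACT-SPLIT
file (librarian, mode `fact-decompose`, 2026-08-16) for the budget-capped XL named fact
`Literature.Topology.FourManifolds.Finashin1996_conjQuotient_exists` (`ArnoldRokhlinQuotient.lean`;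
Finashin, J. reine angew. Math. 481 (1996) §1 ¶2 / Degtyarev–Kharlamov, Russian Math. Surveys 55
(2000) §3.2: the orbit space of an anti-holomorphic involution of a compact complex surface is a
smooth `4`-manifold for which the projection is a double covering branched along the real part).

State of the tree (2026-08-16):
* `Finashin1996_conjQuotient_exists_of_conjQuotient_smoothStructure_exists`
  (`ArnoldRokhlinQuotientProofs.lean`) reduces the fact to the general existence fact
  `conjQuotient_smoothStructure_exists` (`ConjQuotientSmoothing.lean`, no real point assumed, `Y`
  compact);
* `ConjQuotient.AdaptedAtlas.exists_isBranchedDoubleQuotient` (`ConjQuotientAtlas.lean`, PROVED,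
  532 lines) constructs the smooth branched double quotient of ANY continuous involution `σ` of a
  `C^∞` manifold modelled on `ℂ²` from an ADAPTED ATLAS (`ConjQuotient.AdaptedAtlas σ`): charts of the
  `C^∞` maximal atlas with `σ`-invariant sources on which `σ` reads as coordinatewise conjugation,
  covering `X`, whose transition maps descend through the branched double model
  `(z, w) ↦ (Re z, Re w, (Im z)² − (Im w)², 2 Im z Im w)` to `C^∞` germs at common real points;
* anti-holomorphic maps are real-smooth and a complex manifold is a real `C^∞` manifold
  (`Literature.Geometry.Kaehler.isManifold_real_of_isManifold_complex`, `RealStructureSmooth.lean`).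

What is missing is therefore exactly the geometric input of the printed construction (Finashin 1996
§1; Degtyarev–Kharlamov §3.2; Bredon 1972 VI.2): an anti-holomorphic involution of a compact complex
surface ADMITS an adapted atlas — `σ`-linearising holomorphic charts translated off the real locus,
and, along the totally real surface `X_ℝ = Fix σ`, `σ`-invariant exponential tubular charts with
orthonormal normal frames, whose transition maps are conformal-linear on the normal fibres and hence
descend through the squaring map. This file names that input (D-0014 named fact) and records the
PROVED assembly:

* `conj_adaptedAtlas_exists` — every real structure (anti-holomorphic involution) on a compact
  Hausdorff second-countable complex surface admits a `ConjQuotient.AdaptedAtlas`;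
* `conjQuotient_smoothStructure_exists_of_adaptedAtlas` — PROVED: the child implies
  `conjQuotient_smoothStructure_exists`;
* `Finashin1996_conjQuotient_exists_holds_of : conj_adaptedAtlas_exists → Finashin1996_conjQuotient_exists`
  — PROVED.

The child is a statement about charts on `X` (no quotient space occurs), strictly upstream of both
existence facts; it is not a rewording of the parent.

## References

* [Finashin1996] S. Finashin, *Rokhlin conjecture and quotients of complex surfaces by complex
  conjugation*, J. reine angew. Math. 481 (1996) 55–71 = arXiv:dg-ga/9506007, §1 ¶2.
* [DegtyarevKharlamov2000] A. Degtyarev, V. Kharlamov, Russian Math. Surveys 55 (2000)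
  = arXiv:math/0004134, §3.2.
* [Bredon1972] G. E. Bredon, *Introduction to compact transformation groups* (1972), VI.2
  (equivariant tubular neighbourhoods).
-/

noncomputable section

open scoped Manifold ContDiff

namespace Literature.Topology.FourManifolds

/-- NAMED FACT — **an anti-holomorphic involution of a compact complex surface admits a
`σ`-adapted atlas** (the geometric input of the Arnold–Rokhlin smoothing; Finashin 1996 §1 ¶2,
Degtyarev–Kharlamov 2000 §3.2: "one can easily see that, up to isotopy, there is a unique smooth
structure on `X/conj` such that the projection `X → X/conj` is a double covering branched over `ℝX`";
Bredon 1972 VI.2 for the equivariant tubular neighbourhood). For every compact Hausdorff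
second-countable complex surface `X` (`ChartedSpace (Fin 2 → ℂ) X`, `IsManifold 𝓘(ℂ, Fin 2 → ℂ) ω X`)
and every real structure `σ` on it (`Literature.Geometry.Kaehler.IsRealStructure`: an anti-holomorphic
involution), there is an adapted atlas `ConjQuotient.AdaptedAtlas σ` (`ConjQuotientAtlas.lean`): a
family of charts of the real `C^∞` maximal atlas with `σ`-invariant sources on which `σ` reads as
`star` (coordinatewise conjugation), covering `X`, such that at every common real point of two members
the transition map descends through `branchedDoubleModel` to a `C^∞` germ of `ℝ⁴`. Construction in
print: `σ`-linearised holomorphic charts away from `Fix σ`; along the totally real surface `Fix σ`, a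
`σ`-invariant metric, exponential tubular coordinates with orthonormal normal frames (transition maps
conformal-linear on normal fibres, `y ↦ e^{iθ(x)} y` or `e^{iθ(x)} ȳ`, which descend through
`y ↦ y²`). Users take `(h : conj_adaptedAtlas_exists)`.
[cite: Finashin1996, §1 Introduction ¶2 (arXiv:dg-ga/9506007 p. 1)]
[cite: DegtyarevKharlamov2000, §3.2 (arXiv:math/0004134 p. 14)] -/
def conj_adaptedAtlas_exists : Prop :=
  ∀ (X : Type) [TopologicalSpace X] [T2Space X] [SecondCountableTopology X] [CompactSpace X]
    [ChartedSpace (Fin 2 → ℂ) X] [IsManifold 𝓘(ℂ, Fin 2 → ℂ) ω X] (σ : X → X),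
    Literature.Geometry.Kaehler.IsRealStructure 𝓘(ℂ, Fin 2 → ℂ) σ →
    Nonempty (ConjQuotient.AdaptedAtlas σ)

/-- **Assembly, step 1 (PROVED): the general Arnold–Rokhlin existence fact from an adapted atlas** —
the complex surface is a real `C^∞` manifold (`isManifold_real_of_isManifold_complex`), `σ` is
continuous and involutive, and `ConjQuotient.AdaptedAtlas.exists_isBranchedDoubleQuotient` builds the
compact Hausdorff second-countable `C^∞` `4`-manifold `X/σ` with its branched double quotient map.
[cite: DegtyarevKharlamov2000, §3.2 (arXiv:math/0004134 p. 14)] -/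
theorem conjQuotient_smoothStructure_exists_of_adaptedAtlas (h : conj_adaptedAtlas_exists) :
    conjQuotient_smoothStructure_exists := by
  intro X _ _ _ _ _ _ σ hσ
  haveI : IsManifold 𝓘(ℝ, Fin 2 → ℂ) ∞ X :=
    Literature.Geometry.Kaehler.isManifold_real_of_isManifold_complex
  obtain ⟨A⟩ := h X σ hσ
  exact ConjQuotient.AdaptedAtlas.exists_isBranchedDoubleQuotient hσ.2 hσ.1.1 A

/-- **Assembly (PROVED): Finashin 1996 §1 ¶2 from the adapted-atlas fact** — step 1 followed by
`Finashin1996_conjQuotient_exists_of_conjQuotient_smoothStructure_exists` (forget compactness of `Y`;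
an anti-holomorphic involution is a real structure). Discharging the child discharges both
`conjQuotient_smoothStructure_exists` and `Finashin1996_conjQuotient_exists`.
[cite: Finashin1996, §1 Introduction ¶2 (arXiv:dg-ga/9506007 p. 1)] -/
theorem Finashin1996_conjQuotient_exists_holds_of (h : conj_adaptedAtlas_exists) :
    Finashin1996_conjQuotient_exists :=
  Finashin1996_conjQuotient_exists_of_conjQuotient_smoothStructure_exists
    (conjQuotient_smoothStructure_exists_of_adaptedAtlas h)

end Literature.Topology.FourManifolds

end
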